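import Summits.RiemannHypothesis.RiemannHypothesis.Theorems.TiltedLandingLaw421R3Lens1PinningIso

/-!
# TiltedLandingLaw421R3 — lens-1: `TopPinning` on the Jensen-isolated population WITHOUT clean feet (additive follow-up to (3p))

LENS-1 gen-5 ADDITIVE module image `rh33346-cover/lens-1/PinningIsoB-v1.lean` = §1b of `PinningIso-v2.lean` b19b4526 VERBATIM, importing the
landed (3p) `…R3Lens1PinningIso` (`RhW08.Lens1PinningIso.JensenIsolated`, `ne_zero_of_jensenIsolated`, …) instead of carrying §1/§2 again;
namespace `RhW08.Lens1PinningIso` (extended); 0 `sorry`, no instances/notation.  Checkable BY IMPORT only after (3p) lands; until then the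
monolithic `PinningIso-v2.lean` (farm rc 0 · 0 err · 0 warn · 0 sorry) is the certificate that these bytes elaborate after §1.

CONTENT: `exists_uniform_far_gap`, `exists_nl_margin`, `shifted_clear`, ★★★ `pinning_of_jensenIsolated'` (EngineHyps5 + f⁽ʲ⁾ a = 0 + 0 < Im a +
JensenIsolated ⇒ the LITERAL `TopPinning` disjunction), `TopPinningCrossing` (OPEN residual: non-isolated = crossing lower-or-equal mates) with the
exact split `topPinning_of_crossing : TopPinningCrossing → TopPinning` / `crossing_of_topPinning`.
HONEST LABEL: `TopPinning` / `TopPinningCrossing` / `RegUmbrella11S` / 33346 / 33347 OPEN; nothing here bears on the truth of RH; RH is not proved.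
-/

noncomputable section

namespace RhW08.Lens1PinningIso

open Complex Set Metric
open scoped ComplexConjugate
open Literature.Analysis.Complex
open Summit.RiemannHypothesis.RiemannHypothesis.Theorems.Splittings.JensenWindow
open RhIdea6.G17.W07C7 RhIdea6.G17.W07C7.Rev6 RhIdea6.G18.W07C8.Law421BirthS RhIdea6.G19.W07C11.Seam
open RhIdea6.G20.W07C12.Frac RhIdea6.G20.W07C12.StColP RhW07.C12.FieldSplit RhIdea6.G21.W07C13.TentMax
open RhW07.C14.TwoSided RhW07.C14.Classes RhW07.C14.Lineage RhW07.C14.Booking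
open RhW07.C13.Heredity RhIdea6.G22.W07C15pre.Injection RhW07.E3.Cell RhW07.E3.Lit
open RhW08.Round1 RhW08.StSwap RhW08.Round2 RhW08.QuadW RhW08.SealSwapQ RhW08.SealSwap RhW08.SuccB RhW08.SuccSplit
open RhW08.SuccTheft RhW08.Column RhW08.Hurwitz RhW08.ClusterQ RhW08.ClusterQM RhW08.NewtonDoor RhW08.NewtonDoorGenusOne RhW08.PurseP
open RhW08.Lens1SignCut RhW08.Lens1Coverage RhW08.IsolatedTilt RhW08.Lens1Pinning

/-! ## §1b DIRTY FEET REMOVED — generic δ-shifted windows (uniform far gap + finitely many zeros of `G·G′` and NL events near the feet)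

The clean-feet hypothesis of §1 is an artefact of the window's corners.  Shift both feet lines outward by a GENERIC `ε > 0` smaller than
the UNIFORM slack `g` of the strictly-far zeros (`exists_uniform_far_gap`, after `RhW08.SuccB.exists_uniform_gap`) and than the NL MARGIN `m`
(`exists_nl_margin`: finitely many NL events near the base, so an NL event within `Im a + m` of `Re a` is within `Im a`): the shifted corners miss the
finitely many zeros of `f^{(j)}`, `f^{(j+1)}` in the box (`RhW08.SuccB.finite_zeros_box`, `Set.Ioo_infinite`), the sides are (strictly) clear, and the
§1 argument runs verbatim; the conclusion is the LITERAL `TopPinning` disjunction (closed disc / closed base). -/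

/-- UNIFORM SLACK of the STRICTLY FAR non-real zeros of an entire `G ≢ 0` (zeros in `|Im| ≤ Hs`) from the closed disc of `a` — hypothesis-free:
only zeros that ARE strictly far are quantified (finitely many in the box `|Re c − Re a| < Im a + Hs + 2`; slack `≥ 1` outside). -/
theorem exists_uniform_far_gap {G : ℂ → ℂ} (hG : Differentiable ℂ G) (hne : G ≠ 0) {Hs : ℝ}
    (hstrip : ∀ c : ℂ, G c = 0 → |c.im| ≤ Hs) {a : ℂ} (haim : 0 < a.im) (haHs : a.im ≤ Hs) :
    ∃ g : ℝ, 0 < g ∧ g ≤ 1 ∧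
      ∀ c : ℂ, G c = 0 → a.im + |c.im| < |a.re - c.re| → a.im + |c.im| + g ≤ |a.re - c.re| := by
  have hHs : 0 ≤ Hs := le_trans haim.le haHs
  set L : ℝ := a.im + Hs + 2 with hL
  have hz₀ : ((a.re : ℂ)) ∈ Ioo (a.re - L) (a.re + L) ×ℂ Ioo (-(Hs + 1)) (Hs + 1) :=
    ofReal_mem_box (by rw [sub_self, abs_zero]; linarith) hHs
  have hfin := finite_zeros_box hG hne hz₀
  have hout : ∀ c : ℂ, G c = 0 → c ∉ Ioo (a.re - L) (a.re + L) ×ℂ Ioo (-(Hs + 1)) (Hs + 1) →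
      a.im + |c.im| + 1 ≤ |a.re - c.re| := by
    intro c hGc hbox
    have hci : |c.im| ≤ Hs := hstrip c hGc
    have hre : L ≤ |a.re - c.re| := by
      by_contra hlt
      rw [not_le] at hlt
      apply hbox
      rw [mem_reProdIm]
      rw [abs_lt] at hlt
      rw [abs_le] at hci
      exact ⟨⟨by linarith, by linarith⟩, ⟨by linarith, by linarith⟩⟩
    linarith
  set T : Set ℂ := {c : ℂ | G c = 0 ∧ c ∈ Ioo (a.re - L) (a.re + L) ×ℂ Ioo (-(Hs + 1)) (Hs + 1)} ∩
    {c : ℂ | a.im + |c.im| < |a.re - c.re|} with hT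
  have hTfin : T.Finite := hfin.inter_of_left _
  let sl : ℂ → ℝ := fun c => |a.re - c.re| - a.im - |c.im|
  by_cases hTe : T.Nonempty
  · obtain ⟨c₀, hc₀, hmin⟩ := Set.exists_min_image T sl hTfin hTe
    have hsl₀ : 0 < sl c₀ := by
      have h := hc₀.2
      simp only [Set.mem_setOf_eq] at h
      show 0 < |a.re - c₀.re| - a.im - |c₀.im|
      linarith
    refine ⟨min (sl c₀) 1, lt_min hsl₀ one_pos, min_le_right _ _, ?_⟩
    intro c hGc hfar
    by_cases hbox : c ∈ Ioo (a.re - L) (a.re + L) ×ℂ Ioo (-(Hs + 1)) (Hs + 1)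
    · have hcT : c ∈ T := ⟨⟨hGc, hbox⟩, hfar⟩
      have h1 : sl c₀ ≤ sl c := hmin c hcT
      have h2 : min (sl c₀) 1 ≤ sl c₀ := min_le_left _ _
      have h3 : sl c = |a.re - c.re| - a.im - |c.im| := rfl
      linarith
    · have h1 := hout c hGc hbox
      have h2 : min (sl c₀) 1 ≤ 1 := min_le_right _ _
      linarith
  · refine ⟨1, one_pos, le_rfl, ?_⟩
    intro c hGc hfar
    by_cases hbox : c ∈ Ioo (a.re - L) (a.re + L) ×ℂ Ioo (-(Hs + 1)) (Hs + 1)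
    · exact absurd ⟨c, ⟨hGc, hbox⟩, hfar⟩ hTe
    · exact hout c hGc hbox

/-- NL MARGIN: the NL events of level `j` near the base of `a` are finitely many (zeros of `f^{(j+1)} ≢ 0` in a box), so there is
`m ∈ (0, 1]` such that an NL event with `|x − Re a| < Im a + m` already has `|x − Re a| ≤ Im a`. -/
theorem exists_nl_margin {f : ℂ → ℂ} (hf : RealEntireLt2 f) {j : ℕ} (hne : iteratedDeriv (j + 1) f ≠ 0) {a : ℂ} (ha : 0 < a.im) :
    ∃ m : ℝ, 0 < m ∧ m ≤ 1 ∧ ∀ x : ℝ, NLEventOf f j x → |x - a.re| < a.im + m → |x - a.re| ≤ a.im := by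
  have hG'd : Differentiable ℂ (iteratedDeriv (j + 1) f) := differentiable_iteratedDeriv_of_entire hf.diff (j + 1)
  set L : ℝ := a.im + 1 with hL
  have hz₀ : ((a.re : ℂ)) ∈ Ioo (a.re - L) (a.re + L) ×ℂ Ioo (-((0 : ℝ) + 1)) ((0 : ℝ) + 1) :=
    ofReal_mem_box (by rw [sub_self, abs_zero]; linarith) le_rfl
  have hfin := finite_zeros_box hG'd hne hz₀
  set N : Set ℝ := {x : ℝ | NLEventOf f j x ∧ |x - a.re| < a.im + 1 ∧ a.im < |x - a.re|} with hN
  have hNfin : N.Finite := by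
    refine (hfin.preimage Complex.ofReal_injective.injOn).subset ?_
    intro x hx
    refine ⟨?_, ofReal_mem_box (by linarith [hx.2.1] : |x - a.re| < L) le_rfl⟩
    have hre : (iteratedDeriv (j + 1) f (x : ℂ)).re = 0 := hx.1.1
    have him : (iteratedDeriv (j + 1) f (x : ℂ)).im = 0 := im_iteratedDeriv_ofReal hf.diff hf.real (j + 1) x
    exact Complex.ext (by simpa using hre) (by simpa using him)
  by_cases hNe : N.Nonempty
  · obtain ⟨x₁, hx₁, hmin⟩ := Set.exists_min_image N (fun x => |x - a.re| - a.im) hNfin hNe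
    have hm₀ : 0 < |x₁ - a.re| - a.im := by linarith [hx₁.2.2]
    refine ⟨min (|x₁ - a.re| - a.im) 1, lt_min hm₀ one_pos, min_le_right _ _, ?_⟩
    intro x hNL hx
    by_contra hgt
    rw [not_le] at hgt
    have hxN : x ∈ N := ⟨hNL, by linarith [min_le_right (|x₁ - a.re| - a.im) 1], hgt⟩
    have h1 : |x₁ - a.re| - a.im ≤ |x - a.re| - a.im := hmin x hxN
    linarith [min_le_left (|x₁ - a.re| - a.im) 1]
  · refine ⟨1, one_pos, le_rfl, ?_⟩
    intro x hNL hx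
    by_contra hgt
    rw [not_le] at hgt
    exact hNe ⟨x, hNL, hx, hgt⟩

/-- Clearance of the SHIFTED foot lines `Re = Re a ± t`, `Im a ≤ t < Im a + g` (`g` a uniform far gap), from every non-real zero of
`f^{(j)}` of a JENSEN-ISOLATED `a` (strict except for the trivial `≤`). -/
theorem shifted_clear {f : ℂ → ℂ} {j : ℕ} {a : ℂ} (hGreal : ∀ z : ℂ, iteratedDeriv j f (conj z) = conj (iteratedDeriv j f z))
    (hapos : 0 < a.im) (hJ : JensenIsolated f j a) {g t : ℝ}
    (hgap : ∀ c : ℂ, iteratedDeriv j f c = 0 → a.im + |c.im| < |a.re - c.re| → a.im + |c.im| + g ≤ |a.re - c.re|)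
    (hat : a.im ≤ t) (htg : t < a.im + g) {σ : ℝ} (hσ : σ = 1 ∨ σ = -1) :
    ∀ c : ℂ, iteratedDeriv j f c = 0 → c.im ≠ 0 → |c.im| ≤ |(a.re + σ * t) - c.re| := by
  intro c hc hcim
  obtain ⟨c', hc', hc'pos, hc're, hc'im⟩ : ∃ c' : ℂ, iteratedDeriv j f c' = 0 ∧ 0 < c'.im ∧ c'.re = c.re ∧ c'.im = |c.im| := by
    rcases lt_or_gt_of_ne hcim with hneg | hpos
    · refine ⟨conj c, by rw [hGreal, hc, map_zero], by simpa using hneg, by simp, ?_⟩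
      rw [Complex.conj_im, abs_of_neg hneg]
    · exact ⟨c, hc, hpos, rfl, (abs_of_pos hpos).symm⟩
  have htpos : 0 < t := lt_of_lt_of_le hapos hat
  have hσabs : |σ * t| = t := by
    rcases hσ with h | h <;> simp [h, abs_of_pos htpos]
  by_cases hca : c' = a
  · have hre : c.re = a.re := by rw [← hc're, hca]
    have him : |c.im| = a.im := by rw [← hc'im, hca]
    rw [him, hre, show a.re + σ * t - a.re = σ * t by ring, hσabs]
    exact hat
  · rcases hJ c' hc' hc'pos hca with hfar | hnest
    · -- strictly far ⇒ uniform gap `g`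
      rw [hc're, hc'im] at hfar
      have hg' := hgap c hc hfar
      have htri : |a.re - c.re| ≤ |a.re + σ * t - c.re| + |σ * t| := by
        have h := abs_sub (a.re + σ * t - c.re) (σ * t)
        rwa [show a.re + σ * t - c.re - σ * t = a.re - c.re by ring] at h
      rw [hσabs] at htri
      linarith
    · -- strictly nested
      rw [hc're, hc'im] at hnest
      have htri : t ≤ |a.re + σ * t - c.re| + |a.re - c.re| := by
        have h := abs_add_le (a.re + σ * t - c.re) (-(a.re - c.re))
        have e : a.re + σ * t - c.re + -(a.re - c.re) = σ * t := by ring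
        rw [e, hσabs, abs_neg] at h
        exact h
      linarith

/-- ★★★ WALSH–JENSEN PINNING, DIRTY FEET ALLOWED (the literal `TopPinning` conclusion on the Jensen-isolated population, NO smallness,
NO cleanliness): a JENSEN-ISOLATED upper zero `a` of `f^{(j)}` on a legal frame has a non-real zero of `f^{(j+1)}` in its CLOSED Jensen disc
or an NL event of level `j` in the CLOSED base `|x − Re a| ≤ Im a`. -/
theorem pinning_of_jensenIsolated' {η : ℝ} {f : ℂ → ℂ} {x₀ s hmax R Hs : ℝ} {B : ℕ} (hE : EngineHyps5 2 η f x₀ s hmax R Hs B)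
    {j : ℕ} {a : ℂ} (ha : iteratedDeriv j f a = 0) (hapos : 0 < a.im) (hJ : JensenIsolated f j a) :
    (∃ w : ℂ, iteratedDeriv (j + 1) f w = 0 ∧ w.im ≠ 0 ∧ NestedStep a w) ∨ (∃ x : ℝ, |x - a.re| ≤ a.im ∧ NLEventOf f j x) := by
  classical
  have hf : RealEntireLt2 f := realEntireLt2_of_hyps hE
  have hnz : iteratedDeriv j f ≠ 0 := ne_zero_of_jensenIsolated hapos hJ
  set G : ℂ → ℂ := iteratedDeriv j f with hGdef
  have hG : RealEntireLt2 G :=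
    { diff := differentiable_iteratedDeriv_of_entire hf.diff j
      growth := by
        obtain ⟨ρ, C, hρ0, hρ, hgr⟩ := hf.growth
        obtain ⟨ρ', C', h1, h2, h3⟩ := exists_growth_iteratedDeriv hf.diff hρ0 hρ hgr j
        exact ⟨ρ', C', h1, h2, h3⟩
      real := im_iteratedDeriv_ofReal hf.diff hf.real j }
  have hGreal : ∀ z : ℂ, G (conj z) = conj (G z) := apply_conj_eq_conj hG.diff hG.real
  have e1 : deriv G = iteratedDeriv (j + 1) f := by rw [hGdef, ← iteratedDeriv_succ]
  have hHs : 0 ≤ Hs := hE.2.2.2.2.2.2.2.1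
  have hstrip : ∀ c : ℂ, G c = 0 → |c.im| ≤ Hs := fun c hc => abs_im_le_of_level hE hnz hc
  have haHs : a.im ≤ Hs := by have := hstrip a ha; rwa [abs_of_pos hapos] at this
  have hGd : Differentiable ℂ G := hG.diff
  have hG'ne : iteratedDeriv (j + 1) f ≠ 0 := iteratedDeriv_succ_ne_zero_of_zero hf.diff j hnz ha
  have hG'd : Differentiable ℂ (iteratedDeriv (j + 1) f) := differentiable_iteratedDeriv_of_entire hf.diff (j + 1)
  -- the uniform far gap `g` and the NL margin `m`
  obtain ⟨g, hg0, hg1, hgap⟩ := exists_uniform_far_gap hGd hnz hstrip hapos haHs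
  obtain ⟨m, hm0, hm1, hmarg⟩ := exists_nl_margin hf hG'ne hapos (a := a)
  set ε₀ : ℝ := min g m with hε₀
  have hε₀0 : 0 < ε₀ := lt_min hg0 hm0
  -- finitely many zeros of `G`, `G'` in the box ⇒ a GENERIC shift `ε ∈ (0, ε₀)` keeps the four corners clean
  set L : ℝ := a.im + Hs + 2 with hL
  have hz₀ : ((a.re : ℂ)) ∈ Ioo (a.re - L) (a.re + L) ×ℂ Ioo (-(Hs + 1)) (Hs + 1) :=
    ofReal_mem_box (by rw [sub_self, abs_zero]; linarith) hHs
  set Z : Set ℂ := {ρ : ℂ | G ρ = 0 ∧ ρ ∈ Ioo (a.re - L) (a.re + L) ×ℂ Ioo (-(Hs + 1)) (Hs + 1)} ∪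
    {ρ : ℂ | iteratedDeriv (j + 1) f ρ = 0 ∧ ρ ∈ Ioo (a.re - L) (a.re + L) ×ℂ Ioo (-(Hs + 1)) (Hs + 1)} with hZ
  have hZfin : Z.Finite := (finite_zeros_box hGd hnz hz₀).union (finite_zeros_box hG'd hG'ne hz₀)
  let cp : ℝ → ℂ := fun ε => ((a.re + (a.im + ε) : ℝ) : ℂ)
  let cm : ℝ → ℂ := fun ε => ((a.re - (a.im + ε) : ℝ) : ℂ)
  have hcp : Set.InjOn cp (cp ⁻¹' Z) := fun x _ y _ h => by
    have h' : a.re + (a.im + x) = a.re + (a.im + y) := Complex.ofReal_inj.mp h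
    linarith
  have hcm : Set.InjOn cm (cm ⁻¹' Z) := fun x _ y _ h => by
    have h' : a.re - (a.im + x) = a.re - (a.im + y) := Complex.ofReal_inj.mp h
    linarith
  have hbad : (cp ⁻¹' Z ∪ cm ⁻¹' Z).Finite := (hZfin.preimage hcp).union (hZfin.preimage hcm)
  obtain ⟨ε, hεI, hεbad⟩ := ((Set.Ioo_infinite hε₀0).sdiff hbad).nonempty
  obtain ⟨hε0, hε1⟩ := hεI
  have hεg : ε < g := lt_of_lt_of_le hε1 (min_le_left _ _)
  have hεm : ε < m := lt_of_lt_of_le hε1 (min_le_right _ _)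
  have hat : a.im ≤ a.im + ε := by linarith
  have htg : a.im + ε < a.im + g := by linarith
  have hβmem : cp ε ∈ Ioo (a.re - L) (a.re + L) ×ℂ Ioo (-(Hs + 1)) (Hs + 1) :=
    ofReal_mem_box (by rw [show a.re + (a.im + ε) - a.re = a.im + ε by ring, abs_of_pos (by linarith)]; linarith) hHs
  have hαmem : cm ε ∈ Ioo (a.re - L) (a.re + L) ×ℂ Ioo (-(Hs + 1)) (Hs + 1) :=
    ofReal_mem_box (by rw [show a.re - (a.im + ε) - a.re = -(a.im + ε) by ring, abs_neg, abs_of_pos (by linarith)]; linarith) hHs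
  have hGβ : G (cp ε) ≠ 0 := fun h0 => hεbad (Or.inl (Or.inl ⟨h0, hβmem⟩))
  have hG'β : iteratedDeriv (j + 1) f (cp ε) ≠ 0 := fun h0 => hεbad (Or.inl (Or.inr ⟨h0, hβmem⟩))
  have hGα : G (cm ε) ≠ 0 := fun h0 => hεbad (Or.inr (Or.inl ⟨h0, hαmem⟩))
  have hG'α : iteratedDeriv (j + 1) f (cm ε) ≠ 0 := fun h0 => hεbad (Or.inr (Or.inr ⟨h0, hαmem⟩))
  -- the shifted square window is a Jensen window
  have hclL : ∀ c : ℂ, G c = 0 → c.im ≠ 0 → |c.im| ≤ |(a.re - (a.im + ε)) - c.re| := by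
    have h := shifted_clear (f := f) (j := j) hGreal hapos hJ hgap hat htg (σ := -1) (Or.inr rfl)
    intro c hc hcim
    have h1 := h c hc hcim
    rwa [show a.re + -1 * (a.im + ε) = a.re - (a.im + ε) by ring] at h1
  have hclR : ∀ c : ℂ, G c = 0 → c.im ≠ 0 → |c.im| ≤ |(a.re + (a.im + ε)) - c.re| := by
    have h := shifted_clear (f := f) (j := j) hGreal hapos hJ hgap hat htg (σ := 1) (Or.inl rfl)
    intro c hc hcim
    have h1 := h c hc hcim
    rwa [show a.re + 1 * (a.im + ε) = a.re + (a.im + ε) by ring] at h1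
  have hW : Window G (a.re - (a.im + ε)) (a.re + (a.im + ε)) (Hs + 1) := by
    refine ⟨by linarith, by linarith, ?_, ?_, ?_, hGα, hGβ, ?_, ?_⟩
    · exact fun x _ => jensenClear_top (by linarith) (by linarith) hstrip
    · exact fun y _ hy0 => jensenClear_vline hy0 hclL
    · exact fun y _ hy0 => jensenClear_vline hy0 hclR
    · rw [e1]; exact hG'α
    · rw [e1]; exact hG'β
  have hamem : a ∈ Ioo (a.re - (a.im + ε)) (a.re + (a.im + ε)) ×ℂ Ioo (-(Hs + 1)) (Hs + 1) :=
    mem_reProdIm.2 ⟨⟨by linarith, by linarith⟩, ⟨by linarith, by linarith⟩⟩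
  by_cases hB : LocalB G (a.re - (a.im + ε)) (a.re + (a.im + ε))
  · by_cases hA : LocalA G (a.re - (a.im + ε)) (a.re + (a.im + ε)) (Hs + 1)
    · exact absurd (no_nonreal_zero_of_localA_localB hG hW hA hB a hamem ha) hapos.ne'
    · unfold LocalA at hA
      push Not at hA
      obtain ⟨ρ, hρ, hdρ, hρim⟩ := hA
      have hdreal : ∀ x : ℝ, (deriv G x).im = 0 := im_deriv_ofReal hG.diff hG.real
      obtain ⟨w, hw, hdw, hwpos⟩ : ∃ w ∈ Ioo (a.re - (a.im + ε)) (a.re + (a.im + ε)) ×ℂ Ioo (-(Hs + 1)) (Hs + 1),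
          deriv G w = 0 ∧ 0 < w.im := by
        rcases lt_or_gt_of_ne hρim with hneg | hpos
        · refine ⟨conj ρ, ?_, ?_, ?_⟩
          · rw [mem_reProdIm] at hρ ⊢
            obtain ⟨h1, h2, h3⟩ := hρ
            refine ⟨by simpa using h1, ?_, ?_⟩
            · simp only [Complex.conj_im]; linarith [h3]
            · simp only [Complex.conj_im]; linarith [h2]
          · rw [apply_conj_eq_conj hG.diff.deriv hdreal ρ, hdρ, map_zero]
          · simpa using hneg
        · exact ⟨ρ, hρ, hdρ, hpos⟩
      have hfw : iteratedDeriv (j + 1) f w = 0 := by rw [← e1]; exact hdw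
      have hwre : w.re ∈ Ioo (a.re - (a.im + ε)) (a.re + (a.im + ε)) := (mem_reProdIm.mp hw).1
      have hwa : |w.re - a.re| < a.im + ε := by rw [abs_lt]; constructor <;> linarith [hwre.1, hwre.2]
      obtain ⟨c, hc, hcpos, hdisc⟩ := jensen_host_levelj hf j hnz ha hwpos hfw
      refine Or.inl ⟨w, hfw, hwpos.ne', ?_⟩
      show (w.re - a.re) ^ 2 + w.im ^ 2 ≤ a.im ^ 2
      by_cases hca : c = a
      · rw [hca] at hdisc; exact hdisc
      · have hwc : |w.re - c.re| ≤ c.im := abs_le_of_sq_le_sq (by nlinarith [sq_nonneg w.im]) hcpos.le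
        rcases hJ c hc hcpos hca with hfar | hnest
        · -- far: impossible by the UNIFORM gap (`ε < g`)
          exfalso
          have hfar' : a.im + |c.im| < |a.re - c.re| := by rwa [abs_of_pos hcpos]
          have hg' := hgap c hc hfar'
          rw [abs_of_pos hcpos] at hg'
          have := abs_sub_le a.re w.re c.re
          rw [abs_sub_comm a.re w.re] at this
          linarith
        · -- nested: `D̄(c) ⊂ D(a)`
          have h1 : |w.re - a.re| ≤ |w.re - c.re| + |c.re - a.re| := abs_sub_le _ _ _
          have h2 : |c.re - a.re| = |a.re - c.re| := abs_sub_comm _ _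
          have h0 : 0 ≤ |w.re - c.re| := abs_nonneg _
          have h0' : 0 ≤ |a.re - c.re| := abs_nonneg _
          have h3 : (w.re - a.re) ^ 2 = |w.re - a.re| ^ 2 := (sq_abs _).symm
          have h3' : (w.re - c.re) ^ 2 = |w.re - c.re| ^ 2 := (sq_abs _).symm
          have h4 : |w.re - a.re| ^ 2 ≤ (|w.re - c.re| + |a.re - c.re|) ^ 2 := by
            rw [h2] at h1
            exact pow_le_pow_left₀ (abs_nonneg _) h1 2
          have h5 : (|w.re - c.re| + |a.re - c.re|) ^ 2 + w.im ^ 2 ≤ (c.im + |a.re - c.re|) ^ 2 := by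
            rw [h3'] at hdisc
            nlinarith [hdisc, hwc, h0, h0', hcpos.le]
          have h6pos : 0 < c.im + |a.re - c.re| := by positivity
          have h6 : (c.im + |a.re - c.re|) ^ 2 < a.im ^ 2 := by
            have hlt : c.im + |a.re - c.re| < a.im := by linarith
            nlinarith [hlt, h6pos, hapos]
          linarith [h3, h4, h5, h6, sq_nonneg w.im]
  · obtain ⟨x, hx, hNL⟩ := nlEventOf_of_not_localB hf j hB
    have hxa : |x - a.re| < a.im + m := by
      rw [abs_lt]; constructor <;> linarith [hx.1, hx.2]
    exact Or.inr ⟨x, hmarg x hNL hxa, hNL⟩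

/-- The CROSSING-MATE residual of the law: `TopPinning` restricted to NON-isolated zeros (under `NoTallerToucher` this means: some
lower-or-equal mate's circle crosses or touches `a`'s, `residual_of_not_jensenIsolated`).  OPEN statement. -/
def TopPinningCrossing : Prop :=
  ∀ (η : ℝ) (f : ℂ → ℂ) (x₀ s hmax R Hs : ℝ) (B : ℕ), EngineHyps5 2 η f x₀ s hmax R Hs B → ∀ (j : ℕ) (a : ℂ),
    iteratedDeriv j f a = 0 → 0 < a.im → NoTallerToucher f j a → ¬ JensenIsolated f j a →
    (∃ w : ℂ, iteratedDeriv (j + 1) f w = 0 ∧ w.im ≠ 0 ∧ NestedStep a w) ∨ (∃ x : ℝ, |x - a.re| ≤ a.im ∧ NLEventOf f j x)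

/-- ★ REDUCTION OF THE LAW TO ITS RESIDUAL (exact split): `TopPinning ⟸ TopPinningCrossing` — the Jensen-isolated population is a theorem. -/
theorem topPinning_of_crossing (hC : TopPinningCrossing) : TopPinning := by
  intro η f x₀ s hmax R Hs B hE j a ha hapos hN
  by_cases hJ : JensenIsolated f j a
  · exact pinning_of_jensenIsolated' hE ha hapos hJ
  · exact hC η f x₀ s hmax R Hs B hE j a ha hapos hN hJ

/-- Converse (bookkeeping): the split is exact. -/
theorem crossing_of_topPinning (hP : TopPinning) : TopPinningCrossing :=
  fun η f x₀ s hmax R Hs B hE j a ha hapos hN _ => hP η f x₀ s hmax R Hs B hE j a ha hapos hN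

end RhW08.Lens1PinningIso
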